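import Literature.Analysis.FluidPDE.ElgindiL12Corrector
import Literature.Analysis.FluidPDE.ElgindiProfileTail
import Mathlib.Analysis.Calculus.ContDiff.Polynomial
import HarnessLib

/-!
# The radial mode of `Φ_*`: the exact solution of `L_z a = 5αz/(1+z)²`
([Elgindi2021] §8.3 Proposition 8.13, the function `G`; [ElgindiGhoulMasmoudi2021] §2.3.1)

Topic `Literature/Analysis/FluidPDE`. Support file (definitions with bodies and proved theorems, no
named facts) on the proof path of the named fact
`Literature.Analysis.FluidPDE.Elgindi.ElgindiGhoulMasmoudi2021_stabilityCore`
(`ElgindiStabilityDecomposition.lean`). T. M. Elgindi, Ann. of Math. 194 (2021) =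
arXiv:1904.04795, §8.3 Proposition 8.13 (p. 27): "define `G` by
`α²z²∂_{zz}G + α(5+α)z∂_zG = −(15/4)·2αz/(1+z)²` … `G = −(1/4α)L₁₂(F_*) − (3α/(2(5+α)))z/(1+z)² +
(3α/(5+α))z^{−5/α}∫₀^z ρ^{5/α+1}/(1+ρ)³ dρ` … In particular, it is easy to see that
`|G + (1/4α)L₁₂(F_*)|_{W^{4,∞}} ≤ Cα`"; Elgindi–Ghoul–Masmoudi, arXiv:1910.14071, §2.3.1 (p. 9),
(2.10)–(2.12).

**The radial mode.** The coefficient `a(z)` of `sin 2θ` in `Φ_*` solves `L_z a = π(Γ)·r = 5αz/(1+z)²`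
(`L_z = −α²D_z² − 5αD_z`, `D_z = z∂_z`; `π(Γ) = 5c/4` the projection coefficient of `Γ` on `sin 2θ`,
`r = 4αz/(c(1+z)²)` the radial factor of `F_*`). In the tree's vocabulary the decaying solution is
**explicit through the averaging operator `T_p` of `ElgindiL12Corrector.lean`**:

`a(z) = 1/(1+z) + T_{5/α}[ρ/(1+ρ)²](z)`   (`radialMode`),

since `L_z(T_pg) = −α²T_p(D_zg)·…` collapses for `p = 5/α`: `L_zT_pg = −α²D_zg ∘ …`; precisely
`D_zT_pg = g − pT_pg = T_p(D_zg)` (`Dz₁_radAvgU`, `radAvgU_Dz₁`) gives `L_z(T_pr₀) = −α²D_zr₀` and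
`L_z(1/(1+z)) = 5αz/(1+z)² + α²D_zr₀`. This file proves the **exact equation**
(`Lz_radialMode`: `−α²D_z²a − 5αD_za = 5αz/(1+z)²` on `z > 0`), the **smallness of the correction**
`|D_z^j(a − 1/(1+z))| ≤ C_jα/5` (`abs_iterate_Dz₁_radialMode_sub_le`: `|T_pg| ≤ sup|g|/p` and
`D_z^jT_p = T_pD_z^j` on the polynomials in `u = 1/(1+z)`), and smoothness on `z > 0`.
-/

noncomputable section

open Set Real Filter MeasureTheory intervalIntegral Polynomial
open _root_.Topology
open scoped ContDiff

namespace Literature.Analysis.FluidPDE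

namespace Elgindi

/-! ### Polynomials in `u = 1/(1+z)` -/

/-- `P(1/(1+z))`, the radial shapes of the profile (`z/(1+z)² = u − u²`, `1/(1+z) = u`). [folklore] -/
def polyU (P : ℝ[X]) (z : ℝ) : ℝ := P.eval (1 + z)⁻¹

/-- The `D_z`-step on the polynomial: `Q ↦ (X² − X)Q′`. [folklore] -/
def stepU (Q : ℝ[X]) : ℝ[X] := (X ^ 2 - X) * derivative Q

/-- `stepU` keeps the vanishing at `u = 0`. [folklore] -/
theorem eval_zero_stepU (Q : ℝ[X]) : (stepU Q).eval 0 = 0 := by simp [stepU]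

/-- Iterates of `stepU` vanish at `0`. [folklore] -/
theorem eval_zero_iterate_stepU {P : ℝ[X]} (hP : P.eval 0 = 0) (j : ℕ) : (stepU^[j] P).eval 0 = 0 := by
  induction j with
  | zero => simpa using hP
  | succ j ih => rw [Function.iterate_succ_apply']; exact eval_zero_stepU _

/-- The derivative of `polyU P` on `z > −1`. [folklore] -/
theorem hasDerivAt_polyU (P : ℝ[X]) {z : ℝ} (hz : -1 < z) :
    HasDerivAt (polyU P) ((derivative P).eval (1 + z)⁻¹ * (-(1:ℝ) / (1 + z) ^ 2)) z := by
  have hz1 : (1 + z) ≠ 0 := by linarith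
  have hu : HasDerivAt (fun y : ℝ => (1 + y)⁻¹) (-(1 : ℝ) / (1 + z) ^ 2) z := ((hasDerivAt_id' z).const_add 1).fun_inv hz1
  have h := (Polynomial.hasDerivAt P ((1 + z)⁻¹)).comp z hu
  exact h

/-- **`D_z(polyU P) = polyU(stepU P)`** on `z > −1`. [folklore] -/
theorem Dz₁_polyU (P : ℝ[X]) {z : ℝ} (hz : -1 < z) : Dz₁ (polyU P) z = polyU (stepU P) z := by
  have hz1 : (1 + z) ≠ 0 := by linarith
  rw [Dz₁_apply, (hasDerivAt_polyU P hz).deriv]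
  simp only [polyU, stepU, eval_mul, eval_sub, eval_pow, eval_X]
  field_simp
  ring

/-- `polyU P` is continuous on `z > −1`. [folklore] -/
theorem continuousOn_polyU (P : ℝ[X]) : ContinuousOn (polyU P) (Ioi (-1)) := by
  unfold polyU
  refine (Polynomial.continuous_eval₂ _ _).comp_continuousOn ?_ |>.congr fun z _ => rfl
  exact ContinuousOn.inv₀ (by fun_prop) fun z hz => by simp only [mem_Ioi] at hz; linarith

/-- `polyU P` is bounded on `z ≥ 0` when `P(0) = 0`: `|polyU P z| ≤ C`. [folklore] -/
theorem exists_abs_polyU_le {P : ℝ[X]} (hP : P.eval 0 = 0) : ∃ C : ℝ, 0 ≤ C ∧ ∀ z : ℝ, 0 ≤ z → |polyU P z| ≤ C := by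
  obtain ⟨C, hC0, hC⟩ := exists_abs_eval_le_mul hP
  refine ⟨C, hC0, fun z hz => ?_⟩
  have hu0 : 0 ≤ (1 + z)⁻¹ := inv_nonneg.2 (by linarith)
  have hu1 : (1 + z)⁻¹ ≤ 1 := inv_le_one_of_one_le₀ (by linarith)
  exact (hC _ hu0 hu1).trans (by nlinarith)

/-! ### Two lemmas on `D_z` on `(0, ∞)` -/

/-- `D_z` only sees `(0,∞)`. [folklore] -/
theorem Dz₁_congr_Ioi {c c' : ℝ → ℝ} (h : EqOn c c' (Ioi 0)) {z : ℝ} (hz : 0 < z) : Dz₁ c z = Dz₁ c' z :=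
  iterate_Dz₁_congr_Ioi h 1 hz

/-- Additivity of the `D_z`-iterates on `(0,∞)` for functions smooth there. [folklore] -/
theorem iterate_Dz₁_add_Ioi_infty {g₁ g₂ : ℝ → ℝ} (h₁ : ContDiffOn ℝ ∞ g₁ (Ioi 0)) (h₂ : ContDiffOn ℝ ∞ g₂ (Ioi 0)) (l : ℕ)
    {z : ℝ} (hz : 0 < z) :
    (Dz₁^[l] fun R => g₁ R + g₂ R) z = (Dz₁^[l] g₁) z + (Dz₁^[l] g₂) z := by
  induction l generalizing g₁ g₂ z with
  | zero => rfl
  | succ l ih =>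
    have hD : ∀ {g : ℝ → ℝ}, ContDiffOn ℝ ∞ g (Ioi 0) → ContDiffOn ℝ ∞ (Dz₁ g) (Ioi 0) := fun {g} hg => by
      have hd := ((contDiffOn_infty_iff_deriv_of_isOpen isOpen_Ioi).1 hg).2
      have e : Dz₁ g = fun R => R * deriv g R := rfl
      rw [e]; exact contDiffOn_id.mul hd
    have e1 : EqOn (Dz₁ fun R => g₁ R + g₂ R) (fun R => Dz₁ g₁ R + Dz₁ g₂ R) (Ioi 0) := by
      intro r hr
      have d1 : DifferentiableAt ℝ g₁ r := (h₁.differentiableOn (by simp)).differentiableAt (Ioi_mem_nhds hr)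
      have d2 : DifferentiableAt ℝ g₂ r := (h₂.differentiableOn (by simp)).differentiableAt (Ioi_mem_nhds hr)
      show r * deriv (fun R => g₁ R + g₂ R) r = r * deriv g₁ r + r * deriv g₂ r
      rw [deriv_fun_add d1 d2]; ring
    rw [Function.iterate_succ_apply, Function.iterate_succ_apply, Function.iterate_succ_apply, iterate_Dz₁_congr_Ioi e1 l hz]
    exact ih (hD h₁) (hD h₂) hz

/-! ### The averaging operator on the shapes `polyU P` -/

section avg

variable {p : ℝ} (hp : 1 ≤ p)
include hp

/-- The integrand `ρ^{p−1}·polyU P` is continuous on `ρ > −1` (`p ≥ 1`). [folklore] -/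
theorem continuousOn_rpow_mul_polyU (P : ℝ[X]) : ContinuousOn (fun ρ : ℝ => ρ ^ (p - 1) * polyU P ρ) (Ioi (-1)) :=
  (Real.continuous_rpow_const (by linarith)).continuousOn.mul (continuousOn_polyU P)

/-- Interval integrability of the integrand between points of `[0, ∞)`. [folklore] -/
theorem intervalIntegrable_rpow_mul_polyU (P : ℝ[X]) {a b : ℝ} (ha : 0 ≤ a) (hb : 0 ≤ b) :
    IntervalIntegrable (fun ρ : ℝ => ρ ^ (p - 1) * polyU P ρ) volume a b :=
  ((continuousOn_rpow_mul_polyU hp P).mono fun x hx => by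
    simp only [mem_Ioi]; rcases le_total a b with h | h
    · rw [uIcc_of_le h] at hx; linarith [hx.1]
    · rw [uIcc_of_ge h] at hx; linarith [hx.1]).intervalIntegrable

/-- **FTC for the primitive**: `(∫₀^z ρ^{p−1}polyU P)′ = z^{p−1}polyU P(z)` at `z > 0`. [folklore] -/
theorem hasDerivAt_prim_polyU (P : ℝ[X]) {z : ℝ} (hz : 0 < z) :
    HasDerivAt (fun z' => ∫ ρ in (0:ℝ)..z', ρ ^ (p - 1) * polyU P ρ) (z ^ (p - 1) * polyU P z) z := by
  have hc := continuousOn_rpow_mul_polyU hp P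
  have hz' : z ∈ Ioi (-1:ℝ) := by simp only [mem_Ioi]; linarith
  exact integral_hasDerivAt_right (intervalIntegrable_rpow_mul_polyU hp P le_rfl hz.le)
    (hc.stronglyMeasurableAtFilter isOpen_Ioi z hz') (hc.continuousAt (isOpen_Ioi.mem_nhds hz'))

/-- **`D_zT_p(polyU P) = polyU P − p·T_p(polyU P)`** on `z > 0`. [cite: Elgindi2021, §7.5 Lemma 7.10 and §8.3 (pp. 24, 27 of arXiv:1904.04795)] -/
theorem Dz₁_radAvgU (P : ℝ[X]) {z : ℝ} (hz : 0 < z) :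
    Dz₁ (radAvg p (polyU P)) z = polyU P z - p * radAvg p (polyU P) z := by
  have hz0 : z ≠ 0 := hz.ne'
  have h1 : HasDerivAt (fun z' : ℝ => z' ^ (-p)) (-p * z ^ (-p - 1)) z := Real.hasDerivAt_rpow_const (Or.inl hz0)
  have h2 := hasDerivAt_prim_polyU hp P hz
  have h := h1.fun_mul h2
  have e : radAvg p (polyU P) = fun z' => z' ^ (-p) * ∫ ρ in (0:ℝ)..z', ρ ^ (p - 1) * polyU P ρ := rfl
  rw [Dz₁_apply, e, h.deriv]
  simp only
  have e1 : z * (z ^ (-p - 1)) = z ^ (-p) := by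
    rw [show -p - 1 = -p + (-1) by ring, Real.rpow_add hz, Real.rpow_neg_one]; field_simp
  have e2 : z * (z ^ (-p) * z ^ (p - 1)) = 1 := by
    rw [← Real.rpow_add hz, show -p + (p - 1) = -1 by ring, Real.rpow_neg_one]; field_simp
  calc z * (-p * z ^ (-p - 1) * (∫ ρ in (0:ℝ)..z, ρ ^ (p - 1) * polyU P ρ) + z ^ (-p) * (z ^ (p - 1) * polyU P z))
      = -p * (z * z ^ (-p - 1)) * (∫ ρ in (0:ℝ)..z, ρ ^ (p - 1) * polyU P ρ) + (z * (z ^ (-p) * z ^ (p - 1))) * polyU P z := by ring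
    _ = polyU P z - p * (z ^ (-p) * ∫ ρ in (0:ℝ)..z, ρ ^ (p - 1) * polyU P ρ) := by rw [e1, e2]; ring

/-- **`T_p(D_z polyU P) = polyU P − p·T_p(polyU P)`** on `z > 0` (integration by parts; the
boundary term at `0` vanishes since `p ≥ 1`). [cite: Elgindi2021, §7.5 Lemma 7.10 (p. 24 of arXiv:1904.04795): D_RT_p = T_pD_R] -/
theorem radAvgU_Dz₁ (P : ℝ[X]) {z : ℝ} (hz : 0 < z) :
    radAvg p (polyU (stepU P)) z = polyU P z - p * radAvg p (polyU P) z := by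
  have hp0 : p ≠ 0 := by linarith
  -- the integrand of `T_p(stepU P)` is `ρ^p·(polyU P)′`
  set v' : ℝ → ℝ := fun ρ => (derivative P).eval (1 + ρ)⁻¹ * (-(1:ℝ) / (1 + ρ) ^ 2) with hv'
  have hv : ∀ x ∈ uIcc (0:ℝ) z, HasDerivAt (polyU P) (v' x) x := by
    intro x hx; rw [uIcc_of_le hz.le] at hx; exact hasDerivAt_polyU P (by linarith [hx.1])
  have hu : ∀ x ∈ uIcc (0:ℝ) z, HasDerivAt (fun ρ : ℝ => ρ ^ p) (p * x ^ (p - 1)) x := by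
    intro x _; exact Real.hasDerivAt_rpow_const (Or.inr hp)
  have hu'i : IntervalIntegrable (fun x : ℝ => p * x ^ (p - 1)) volume 0 z :=
    ((Real.continuous_rpow_const (by linarith)).const_mul p).intervalIntegrable _ _
  have hv'c : ContinuousOn v' (Ioi (-1)) := by
    rw [hv']
    refine ((Polynomial.continuous_eval₂ _ _).comp_continuousOn ?_).mul ?_
    · exact ContinuousOn.inv₀ (by fun_prop) fun x hx => by simp only [mem_Ioi] at hx; linarith
    · exact ContinuousOn.div continuousOn_const (by fun_prop) fun x hx => by simp only [mem_Ioi] at hx; exact pow_ne_zero 2 (by linarith)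
  have hv'i : IntervalIntegrable v' volume 0 z :=
    (hv'c.mono fun x hx => by rw [uIcc_of_le hz.le] at hx; simp only [mem_Ioi]; linarith [hx.1]).intervalIntegrable
  have hibp := integral_mul_deriv_eq_deriv_mul hu hv hu'i hv'i
  -- `∫₀^z ρ^p v' = z^p·polyU P z − 0 − ∫₀^z pρ^{p−1}·polyU P`
  have e1 : ∫ ρ in (0:ℝ)..z, ρ ^ (p - 1) * polyU (stepU P) ρ = ∫ ρ in (0:ℝ)..z, ρ ^ p * v' ρ := by
    refine integral_congr fun ρ hρ => ?_
    rw [uIcc_of_le hz.le] at hρ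
    have hρ1 : -1 < ρ := by linarith [hρ.1]
    rw [← Dz₁_polyU P hρ1, Dz₁_apply, (hasDerivAt_polyU P hρ1).deriv]
    rcases eq_or_lt_of_le hρ.1 with h | h
    · rw [← h]; simp [Real.zero_rpow hp0]
    · rw [show ρ ^ p = ρ ^ (p - 1) * ρ by rw [Real.rpow_sub_one h.ne']; field_simp]
      ring
  unfold radAvg
  rw [e1, hibp, Real.zero_rpow hp0]
  simp only [zero_mul, sub_zero]
  have e2 : ∫ x in (0:ℝ)..z, p * x ^ (p - 1) * polyU P x = p * ∫ x in (0:ℝ)..z, x ^ (p - 1) * polyU P x := by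
    rw [← intervalIntegral.integral_const_mul]; exact integral_congr fun x _ => by ring
  rw [e2]
  have e3 : z ^ (-p) * z ^ p = 1 := by rw [← Real.rpow_add hz, neg_add_cancel, Real.rpow_zero]
  calc z ^ (-p) * (z ^ p * polyU P z - p * ∫ x in (0:ℝ)..z, x ^ (p - 1) * polyU P x)
      = (z ^ (-p) * z ^ p) * polyU P z - p * (z ^ (-p) * ∫ x in (0:ℝ)..z, x ^ (p - 1) * polyU P x) := by ring
    _ = polyU P z - p * (z ^ (-p) * ∫ x in (0:ℝ)..z, x ^ (p - 1) * polyU P x) := by rw [e3, one_mul]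

/-- **Commutation `D_zT_p = T_pD_z` on the shapes, iterated: `D_z^jT_p(polyU P) = T_p(polyU(stepU^jP))`**
on `z > 0`. [folklore] -/
theorem iterate_Dz₁_radAvgU (P : ℝ[X]) (j : ℕ) : ∀ z : ℝ, 0 < z → (Dz₁^[j] (radAvg p (polyU P))) z = radAvg p (polyU (stepU^[j] P)) z := by
  induction j generalizing P with
  | zero => intro z _; rfl
  | succ j ih =>
    intro z hz
    rw [Function.iterate_succ_apply, Function.iterate_succ_apply]
    have e1 : EqOn (Dz₁ (radAvg p (polyU P))) (radAvg p (polyU (stepU P))) (Ioi 0) := fun w hw => by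
      rw [Dz₁_radAvgU hp P hw, radAvgU_Dz₁ hp P hw]
    rw [iterate_Dz₁_congr_Ioi e1 j hz]
    exact ih (stepU P) z hz

/-- **`|T_pg(z)| ≤ G/p`** when `|g| ≤ G` on `(0, z]`. [cite: Elgindi2021, §8.3 (p. 27 of arXiv:1904.04795): "it is easy to see that |G + (1/4α)L₁₂(F_*)|_{W^{4,∞}} ≤ Cα"] -/
theorem abs_radAvg_polyU_le (P : ℝ[X]) {G : ℝ} (hG : ∀ ρ : ℝ, 0 ≤ ρ → |polyU P ρ| ≤ G) {z : ℝ} (hz : 0 < z) :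
    |radAvg p (polyU P) z| ≤ G / p := by
  have hp0 : 0 < p := by linarith
  have hG0 : 0 ≤ G := (abs_nonneg _).trans (hG 0 le_rfl)
  have hI : |∫ ρ in (0:ℝ)..z, ρ ^ (p - 1) * polyU P ρ| ≤ G * (z ^ p / p) := by
    have hle : ∀ x ∈ Icc (0:ℝ) z, |x ^ (p - 1) * polyU P x| ≤ G * x ^ (p - 1) := by
      intro x hx
      rw [abs_mul, abs_of_nonneg (Real.rpow_nonneg hx.1 _), mul_comm]
      exact mul_le_mul_of_nonneg_right (hG x hx.1) (Real.rpow_nonneg hx.1 _)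
    have hint : ∫ x in (0:ℝ)..z, x ^ (p - 1) = z ^ p / p := by
      rw [integral_rpow (Or.inl (by linarith))]
      rw [show p - 1 + 1 = p by ring, Real.zero_rpow hp0.ne']; ring
    calc |∫ ρ in (0:ℝ)..z, ρ ^ (p - 1) * polyU P ρ| ≤ ∫ ρ in (0:ℝ)..z, |ρ ^ (p - 1) * polyU P ρ| := abs_integral_le_integral_abs hz.le
      _ ≤ ∫ ρ in (0:ℝ)..z, G * ρ ^ (p - 1) := by
          refine integral_mono_on hz.le (intervalIntegrable_rpow_mul_polyU hp P le_rfl hz.le).norm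
            (((Real.continuous_rpow_const (by linarith)).const_mul G).intervalIntegrable _ _) hle
      _ = G * (z ^ p / p) := by rw [intervalIntegral.integral_const_mul, hint]
  unfold radAvg
  rw [abs_mul, abs_of_nonneg (Real.rpow_nonneg hz.le _)]
  calc z ^ (-p) * |∫ ρ in (0:ℝ)..z, ρ ^ (p - 1) * polyU P ρ| ≤ z ^ (-p) * (G * (z ^ p / p)) :=
        mul_le_mul_of_nonneg_left hI (Real.rpow_nonneg hz.le _)
    _ = G / p := by
        have e3 : z ^ (-p) * z ^ p = 1 := by rw [← Real.rpow_add hz, neg_add_cancel, Real.rpow_zero]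
        calc z ^ (-p) * (G * (z ^ p / p)) = (z ^ (-p) * z ^ p) * G / p := by ring
          _ = G / p := by rw [e3, one_mul]

/-- **Uniform bounds for the `D_z`-words of `T_p(polyU P)`**: `|D_z^jT_p(polyU P)| ≤ C_j/p` on `z > 0`
(`P(0) = 0`, `p ≥ 1`). [folklore] -/
theorem exists_abs_iterate_Dz₁_radAvgU_le {P : ℝ[X]} (hP : P.eval 0 = 0) (j : ℕ) :
    ∃ C : ℝ, 0 ≤ C ∧ ∀ z : ℝ, 0 < z → |(Dz₁^[j] (radAvg p (polyU P))) z| ≤ C / p := by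
  obtain ⟨C, hC0, hC⟩ := exists_abs_polyU_le (eval_zero_iterate_stepU hP j)
  refine ⟨C, hC0, fun z hz => ?_⟩
  rw [iterate_Dz₁_radAvgU hp P j z hz]
  exact abs_radAvg_polyU_le hp _ hC hz

/-- **`T_p(polyU P) ∈ C^∞(0, ∞)`.** [folklore] -/
theorem contDiffOn_radAvgU (P : ℝ[X]) : ContDiffOn ℝ ∞ (radAvg p (polyU P)) (Ioi 0) := by
  have hpow : ContDiffOn ℝ ∞ (fun R : ℝ => R ^ (-p)) (Ioi 0) := fun R hR =>
    (Real.contDiffAt_rpow_const_of_ne (p := -p) (ne_of_gt hR)).contDiffWithinAt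
  have hpoly : ContDiffOn ℝ ∞ (polyU P) (Ioi (-1)) := by
    have hev : ContDiff ℝ ∞ (fun x : ℝ => P.eval x) := by
      have h := Polynomial.contDiff_aeval (𝕜 := ℝ) P ((⊤ : ℕ∞) : WithTop ℕ∞)
      simpa only [Polynomial.coe_aeval_eq_eval] using h
    have hinv : ContDiffOn ℝ ∞ (fun z : ℝ => (1 + z)⁻¹) (Ioi (-1)) :=
      ContDiffOn.inv (by fun_prop) fun z hz => by simp only [mem_Ioi] at hz; linarith
    exact (hev.comp_contDiffOn hinv).congr fun z _ => rfl
  have hderiv : ContDiffOn ℝ ∞ (fun R : ℝ => R ^ (p - 1) * polyU P R) (Ioi 0) := fun R hR =>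
    ((Real.contDiffAt_rpow_const_of_ne (p := p - 1) (ne_of_gt hR)).mul (hpoly.contDiffAt (isOpen_Ioi.mem_nhds (by simp only [mem_Ioi] at hR ⊢; linarith)))).contDiffWithinAt
  have hM : ∀ n : ℕ, ContDiffOn ℝ n (fun R => ∫ ρ in (0:ℝ)..R, ρ ^ (p - 1) * polyU P ρ) (Ioi 0) := by
    intro n
    induction n with
    | zero => exact contDiffOn_zero.2 fun R hR => (hasDerivAt_prim_polyU hp P hR).continuousAt.continuousWithinAt
    | succ n ih =>
      refine (contDiffOn_succ_iff_deriv_of_isOpen (n := (n : WithTop ℕ∞)) isOpen_Ioi).2 ⟨fun R hR => (hasDerivAt_prim_polyU hp P hR).differentiableAt.differentiableWithinAt,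
        fun h => absurd h (by exact_mod_cast WithTop.natCast_ne_top n), ?_⟩
      have e : EqOn (deriv fun R => ∫ ρ in (0:ℝ)..R, ρ ^ (p - 1) * polyU P ρ) (fun R : ℝ => R ^ (p - 1) * polyU P R) (Ioi 0) :=
        fun R hR => (hasDerivAt_prim_polyU hp P hR).deriv
      exact (hderiv.of_le (by exact_mod_cast le_top)).congr e
  have e : radAvg p (polyU P) = fun R => R ^ (-p) * ∫ ρ in (0:ℝ)..R, ρ ^ (p - 1) * polyU P ρ := rfl
  rw [e]
  exact hpow.mul (contDiffOn_infty.2 hM)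

end avg

/-! ### The radial mode -/

/-- `D_z(1/(1+z)) = −z/(1+z)²` (`= u² − u`). [folklore] -/
theorem Dz₁_inv_one_add {z : ℝ} (hz : 0 < z) : Dz₁ (fun z' : ℝ => (1 + z')⁻¹) z = -(z / (1 + z) ^ 2) := by
  have hz1 : (1 + z) ≠ 0 := by positivity
  rw [Dz₁_apply, (((hasDerivAt_id' z).const_add 1).fun_inv hz1).deriv]
  field_simp

/-- `D_z²(1/(1+z)) = −z(1−z)/(1+z)³`. [folklore] -/
theorem Dz₁_Dz₁_inv_one_add {z : ℝ} (hz : 0 < z) : Dz₁ (Dz₁ fun z' : ℝ => (1 + z')⁻¹) z = -(z * (1 - z) / (1 + z) ^ 3) := by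
  have hz1 : (1 + z) ≠ 0 := by positivity
  have heq : Dz₁ (fun z' : ℝ => (1 + z')⁻¹) =ᶠ[𝓝 z] fun z' => -(z' / (1 + z') ^ 2) := by
    filter_upwards [isOpen_Ioi.mem_nhds hz] with w hw using Dz₁_inv_one_add hw
  have hd : HasDerivAt (fun z' : ℝ => -(z' / (1 + z') ^ 2)) (-((1 * (1 + z) ^ 2 - z * (((2:ℕ):ℝ) * (1 + z) ^ (2 - 1) * 1)) / ((1 + z) ^ 2) ^ 2)) z :=
    ((hasDerivAt_id' z).fun_div (((hasDerivAt_id' z).const_add 1).fun_pow 2) (pow_ne_zero 2 hz1)).neg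
  rw [Dz₁_apply, heq.deriv_eq, hd.deriv]
  push_cast
  field_simp
  ring


/-- The shape `r₀ = z/(1+z)² = u − u²` as a polynomial in `u`. [folklore] -/
def shapeR0 : ℝ[X] := X - X ^ 2

/-- `polyU shapeR0 z = z/(1+z)²` for `z > −1`. [folklore] -/
theorem polyU_shapeR0 {z : ℝ} (hz : -1 < z) : polyU shapeR0 z = z / (1 + z) ^ 2 := by
  have hz1 : (1 + z) ≠ 0 := by linarith
  simp only [polyU, shapeR0, eval_sub, eval_X, eval_pow]
  field_simp
  ring

/-- **The radial mode `a(z) = 1/(1+z) + T_{5/α}[ρ/(1+ρ)²](z)`** of `Φ_*`: the decaying solution of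
`L_za = 5αz/(1+z)²`. [cite: Elgindi2021, §8.3 Proposition 8.13, the function G (p. 27 of arXiv:1904.04795); ElgindiGhoulMasmoudi2021, §2.3.1 (2.10)–(2.12) (p. 9 of arXiv:1910.14071)] -/
def radialMode (α z : ℝ) : ℝ := (1 + z)⁻¹ + radAvg (5 / α) (polyU shapeR0) z

section mode

variable {α : ℝ} (hα : 0 < α) (hα5 : α ≤ 5)
include hα hα5

/-- `5/α ≥ 1` for `0 < α ≤ 5`. [folklore] -/
private theorem five_div_ge_one : 1 ≤ 5 / α := by rw [le_div_iff₀ hα]; linarith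

/-- `a ∈ C^∞(0, ∞)`. [folklore] -/
theorem contDiffOn_radialMode : ContDiffOn ℝ ∞ (radialMode α) (Ioi 0) := by
  have h1 : ContDiffOn ℝ ∞ (fun z : ℝ => (1 + z)⁻¹) (Ioi 0) := ContDiffOn.inv (by fun_prop) fun z hz => by simp only [mem_Ioi] at hz; positivity
  have h2 := contDiffOn_radAvgU (five_div_ge_one hα hα5) shapeR0
  exact (h1.add h2).congr fun z _ => rfl

/-- **The exact equation of the radial mode: `−α²D_z²a − 5αD_za = 5αz/(1+z)²`** on `z > 0`
(`L_zT_pr₀ = −α²D_zr₀` for `p = 5/α`, and `L_z(1/(1+z)) = 5αz/(1+z)² + α²D_zr₀`). [cite: Elgindi2021, §8.3 Proposition 8.13 (p. 27 of arXiv:1904.04795): "α²z²∂_{zz}G + α(5+α)z∂_zG = −(15/4)·2αz/(1+z)²"] -/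
theorem Lz_radialMode {z : ℝ} (hz : 0 < z) :
    -α ^ 2 * Dz₁ (Dz₁ (radialMode α)) z - 5 * α * Dz₁ (radialMode α) z = 5 * α * z / (1 + z) ^ 2 := by
  have hp := five_div_ge_one hα hα5
  have hz1 : (1 + z) ≠ 0 := by positivity
  set M : ℝ → ℝ := radAvg (5 / α) (polyU shapeR0) with hM
  -- `D_z` of the two pieces, as functions on `(0,∞)`
  have hdiffU : ∀ w : ℝ, 0 < w → DifferentiableAt ℝ (fun z' : ℝ => (1 + z')⁻¹) w := fun w hw =>
    (((hasDerivAt_id' w).const_add 1).fun_inv (by positivity)).differentiableAt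
  have hdiffM : ∀ w : ℝ, 0 < w → DifferentiableAt ℝ M w := fun w hw =>
    ((contDiffOn_radAvgU hp shapeR0).differentiableOn (by simp) w hw).differentiableAt (isOpen_Ioi.mem_nhds hw)
  have hadd : ∀ w : ℝ, 0 < w → Dz₁ (radialMode α) w = Dz₁ (fun z' : ℝ => (1 + z')⁻¹) w + Dz₁ M w := by
    intro w hw
    have e : radialMode α = fun z' => (1 + z')⁻¹ + M z' := rfl
    rw [e, Dz₁_apply, Dz₁_apply, Dz₁_apply, deriv_fun_add (hdiffU w hw) (hdiffM w hw)]; ring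
  have hM1 : ∀ w : ℝ, 0 < w → Dz₁ M w = polyU shapeR0 w - 5 / α * M w := fun w hw => Dz₁_radAvgU hp shapeR0 hw
  -- second `D_z`
  have hadd2 : Dz₁ (Dz₁ (radialMode α)) z = Dz₁ (Dz₁ fun z' : ℝ => (1 + z')⁻¹) z + Dz₁ (Dz₁ M) z := by
    rw [Dz₁_congr_Ioi (fun w hw => hadd w hw) hz]
    have hd1 : DifferentiableAt ℝ (Dz₁ fun z' : ℝ => (1 + z')⁻¹) z := by
      have heq : Dz₁ (fun z' : ℝ => (1 + z')⁻¹) =ᶠ[𝓝 z] fun z' => -(z' / (1 + z') ^ 2) := by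
        filter_upwards [isOpen_Ioi.mem_nhds hz] with w hw using Dz₁_inv_one_add hw
      refine DifferentiableAt.congr_of_eventuallyEq ?_ heq
      exact ((differentiableAt_id.fun_div ((differentiableAt_id.const_add (1:ℝ)).pow 2) (pow_ne_zero 2 hz1))).neg
    have hd2 : DifferentiableAt ℝ (Dz₁ M) z := by
      have heq : Dz₁ M =ᶠ[𝓝 z] fun w => polyU shapeR0 w - 5 / α * M w := by
        filter_upwards [isOpen_Ioi.mem_nhds hz] with w hw using hM1 w hw
      refine DifferentiableAt.congr_of_eventuallyEq ?_ heq
      exact (hasDerivAt_polyU shapeR0 (by linarith : (-1:ℝ) < z)).differentiableAt.sub ((hdiffM z hz).const_mul _)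
    rw [Dz₁_apply, Dz₁_apply, Dz₁_apply, deriv_fun_add hd1 hd2]; ring
  have hM2 : Dz₁ (Dz₁ M) z = polyU (stepU shapeR0) z - 5 / α * (polyU shapeR0 z - 5 / α * M z) := by
    rw [Dz₁_congr_Ioi (fun w hw => hM1 w hw) hz]
    have hdP := hasDerivAt_polyU shapeR0 (by linarith : (-1:ℝ) < z)
    have hdM : HasDerivAt M (deriv M z) z := (hdiffM z hz).hasDerivAt
    have h := hdP.fun_sub (hdM.const_mul (5 / α))
    rw [Dz₁_apply, h.deriv, ← Dz₁_polyU shapeR0 (by linarith : (-1:ℝ) < z), Dz₁_apply, hdP.deriv, ← hM1 z hz, Dz₁_apply]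
    ring
  rw [hadd2, hadd z hz, hM1 z hz, hM2, Dz₁_Dz₁_inv_one_add hz, Dz₁_inv_one_add hz, polyU_shapeR0 (by linarith)]
  have eS : polyU (stepU shapeR0) z = z * (1 - z) / (1 + z) ^ 3 := by
    rw [← Dz₁_polyU shapeR0 (by linarith : (-1:ℝ) < z)]
    have heq : polyU shapeR0 =ᶠ[𝓝 z] fun w => w / (1 + w) ^ 2 := by
      filter_upwards [isOpen_Ioi.mem_nhds hz] with w hw using polyU_shapeR0 (by simp only [mem_Ioi] at hw; linarith)
    have hd : HasDerivAt (fun w : ℝ => w / (1 + w) ^ 2) ((1 * (1 + z) ^ 2 - z * (((2:ℕ):ℝ) * (1 + z) ^ (2 - 1) * 1)) / ((1 + z) ^ 2) ^ 2) z :=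
      (hasDerivAt_id' z).fun_div (((hasDerivAt_id' z).const_add 1).fun_pow 2) (pow_ne_zero 2 hz1)
    rw [Dz₁_apply, heq.deriv_eq, hd.deriv]
    push_cast; field_simp; ring
  rw [eS]
  field_simp
  ring

end mode

/-- **The correction `a − 1/(1+z)` has all `D_z`-words `O(α)`**: `|D_z^j(a − 1/(1+z))| ≤ C_j·α/5` on
`z > 0`, uniformly in `0 < α ≤ 5`. [cite: Elgindi2021, §8.3 (p. 27 of arXiv:1904.04795): "|G + (1/4α)L₁₂(F_*)|_{W^{4,∞}} ≤ Cα"] -/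
theorem abs_iterate_Dz₁_radialMode_sub_le (j : ℕ) :
    ∃ C : ℝ, 0 ≤ C ∧ ∀ α : ℝ, 0 < α → α ≤ 5 → ∀ z : ℝ, 0 < z →
      |(Dz₁^[j] (fun z' => radialMode α z' - (1 + z')⁻¹)) z| ≤ C * (α / 5) := by
  obtain ⟨C, hC0, hC⟩ := exists_abs_polyU_le (eval_zero_iterate_stepU (P := shapeR0) (by simp [shapeR0]) j)
  refine ⟨C, hC0, fun α hα hα5 z hz => ?_⟩
  have hp : 1 ≤ 5 / α := by rw [le_div_iff₀ hα]; linarith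
  have e : (fun z' => radialMode α z' - (1 + z')⁻¹) = radAvg (5 / α) (polyU shapeR0) := by
    funext z'; simp [radialMode]
  rw [e, iterate_Dz₁_radAvgU hp shapeR0 j z hz]
  calc |radAvg (5 / α) (polyU (stepU^[j] shapeR0)) z| ≤ C / (5 / α) := abs_radAvg_polyU_le hp _ hC hz
    _ = C * (α / 5) := by field_simp

/-- **`|D_za| ≤ 1/4 + C·α/5` and `|a| ≤ 1 + C·α/5`-type bounds**: the words of the radial mode are
bounded on `z > 0`, uniformly in `0 < α ≤ 5`. [folklore] -/
theorem abs_iterate_Dz₁_radialMode_le (j : ℕ) :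
    ∃ C : ℝ, 0 ≤ C ∧ ∀ α : ℝ, 0 < α → α ≤ 5 → ∀ z : ℝ, 0 < z → |(Dz₁^[j] (radialMode α)) z| ≤ C := by
  obtain ⟨C₁, hC₁, h₁⟩ := abs_iterate_Dz₁_radialMode_sub_le j
  -- the words of `1/(1+z) = polyU X`
  obtain ⟨C₂, hC₂, h₂⟩ := exists_abs_polyU_le (eval_zero_iterate_stepU (P := (X : ℝ[X])) (by simp) j)
  refine ⟨C₁ + C₂, by positivity, fun α hα hα5 z hz => ?_⟩
  have hU : ∀ w : ℝ, 0 < w → (1 + w)⁻¹ = polyU X w := fun w _ => by simp [polyU]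
  have hiterU : (Dz₁^[j] (fun z' : ℝ => (1 + z')⁻¹)) z = polyU (stepU^[j] X) z := by
    rw [iterate_Dz₁_congr_Ioi (fun w hw => hU w hw) j hz]
    clear h₁ h₂ hC₁ hC₂
    induction j generalizing z with
    | zero => rfl
    | succ j ih =>
      rw [Function.iterate_succ_apply', Function.iterate_succ_apply']
      rw [Dz₁_congr_Ioi (fun w hw => ih w hw) hz]
      exact Dz₁_polyU _ (by linarith)
  have hsplit : (Dz₁^[j] (radialMode α)) z = (Dz₁^[j] (fun z' => radialMode α z' - (1 + z')⁻¹)) z + (Dz₁^[j] (fun z' : ℝ => (1 + z')⁻¹)) z := by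
    have e : radialMode α = fun z' => (fun z' => radialMode α z' - (1 + z')⁻¹) z' + (fun z' : ℝ => (1 + z')⁻¹) z' := by funext z'; ring
    conv_lhs => rw [e]
    have hsub : (fun z' => radialMode α z' - (1 + z')⁻¹) = radAvg (5 / α) (polyU shapeR0) := by funext z'; simp [radialMode]
    rw [hsub]
    exact iterate_Dz₁_add_Ioi_infty (contDiffOn_radAvgU (by rw [le_div_iff₀ hα]; linarith) shapeR0)
      (ContDiffOn.inv (by fun_prop) fun w hw => by simp only [mem_Ioi] at hw; positivity) j hz
  rw [hsplit]
  calc |(Dz₁^[j] (fun z' => radialMode α z' - (1 + z')⁻¹)) z + (Dz₁^[j] (fun z' : ℝ => (1 + z')⁻¹)) z|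
      ≤ |(Dz₁^[j] (fun z' => radialMode α z' - (1 + z')⁻¹)) z| + |(Dz₁^[j] (fun z' : ℝ => (1 + z')⁻¹)) z| := abs_add_le _ _
    _ ≤ C₁ * (α / 5) + C₂ := add_le_add (h₁ α hα hα5 z hz) (by rw [hiterU]; exact h₂ z hz.le)
    _ ≤ C₁ + C₂ := by nlinarith


end Elgindi

end Literature.Analysis.FluidPDE
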